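import Mathlib.Algebra.BigOperators.Group.Finset.Basic
import Mathlib.Algebra.Group.Int.Units
import Mathlib.Algebra.Group.Nat.Even
import Mathlib.Tactic.Ring
import Mathlib.Tactic.Push
import Mathlib.Data.List.Count
import Mathlib.Data.Fintype.Basic
import HarnessLib

/-!
# Legendrian Kirby diagrams in Gompf standard form (combinatorial layer)

A compact Stein surface is a 4-dimensional handlebody `B⁴ ∪ n 1-handles ∪ m 2-handles` whose
2-handles are attached along a Legendrian link `K₁, …, Kₘ` in `(#ⁿ S¹ × S², ξ_std)` with framings
`tb(Kᵢ) - 1` (Eliashberg; Gompf 1998, Thm 1.3 and Prop 2.3). Gompf's **standard form**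
(Gompf 1998, Def 2.1) draws such a link as a *front diagram in a box*: `n` pairs of horizontally
aligned distinguished segments (the attaching balls of the 1-handles) on the two vertical sides
of the box, and the front projection of a generic Legendrian tangle in `(ℝ³, dz + x dy)` inside
the box whose end points lie on the distinguished segments, aligned horizontally in pairs. In
standard form the classical invariants are read off combinatorially (Gompf 1998, (1.1), (1.2)
and §2, p. 626):

* `tb(K) = w(K) - ½ (λ(K) + ρ(K)) = w(K) - λ(K)`, where `w` is the writhe (signed number of
  self-crossings of the front of `K`) and `λ`, `ρ` are the numbers of left and right cusps;
* `r(K) = λ₋ - ρ₊ = ρ₋ - λ₊ = ½ (t₋ - t₊)`, where `λ₋` (`ρ₊`) counts the left cusps traversed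
  downwards (right cusps traversed upwards) and `t₋`, `t₊` all downward / upward cusps.

This file provides the **combinatorial layer** of such diagrams, in the style of
`Literature.Topology.FourManifolds.GaussDiagram` (`GaussDiagrams.lean`) and `Literature.Topology.FourManifolds.FramedLink` (`KirbyMoves.lean`):

* `Literature.LegendrianFrontEvent n c`: the events met when traversing one component of a front in
  standard form with `n` 1-handles and `c` crossings — a cusp (left/right, traversed
  downwards/upwards), the over- or under-passage through crossing `k`, or a passage through the
  1-handle `j` (rightwards: leaving the box through the right-hand ball of the pair and re-entering
  through the left-hand one, or leftwards);
* `Literature.Topology.FourManifolds.LegendrianKirbyDiagram`: `oneHandles = n`, `comps = m` components (= 2-handles),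
  `crossings = c` crossings with signs `sign k ∈ ℤˣ`, the cyclic event word `front i` of each
  component, the components `overComp k`, `underComp k` of the two strands of each crossing, and
  the two combinatorial constraints of a front in standard form that make (1.1)/(1.2) meaningful:
  every crossing is passed over exactly once and under exactly once (by the recorded components),
  and every component has as many left cusps as right cusps (left and right cusps alternate along
  a front, passages through 1-handles preserving the direction of travel);
* the invariants `leftCusps`, `rightCusps`, `cusps`, `downCusps`, `upCusps`, `writhe`,
  `tb` (Formula (1.1)), `rot` (Formula (1.2)), the algebraic number of passages `algPass i j` of
  component `i` over the 1-handle `j`, the **Kirby framing** `framing i = tb i - 1` of the `i`-th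
  2-handle (Prop 2.3) and the handle count `handleCount = (1, n, m, 0, 0, …)`;
* API: `two_mul_tb` (`2 tb = 2 w - (λ + ρ)`, i.e. the first form of (1.1)), `two_mul_rot`
  (`2 r = t₋ - t₊`, the last form of (1.2)), `rot_eq_rightDown_sub_leftUp` (the middle form of
  (1.2)), unfolding lemmas, the empty diagram.

## What is *not* here (scope note for requesters)

The *geometric* layers — (a) the realisation predicate "this Legendrian tangle in
`(ℝ³, dz + x dy)`, in the box with these balls, has front word `D`" (Gompf 1998, Def 2.1 item 3,
Thm 2.2) and (b) "the compact 4-manifold `X` is the handlebody `B⁴ ∪ n h¹ ∪ m h²` with 2-handles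
attached along the realised link with framings `D.framing`" (needed to state Prop 2.3 /
Eliashberg's theorem as a named fact) — require contact structures on 3-manifolds and
4-dimensional handle attachment *along a prescribed framed link*, neither of which exists in
Mathlib or in `Literature/` at present (`Handles.lean` is Morse-theoretic: `IsHandleAttachment`,
`HasHandleDecomposition` fix handle numbers, not attaching maps; `KirbyMoves.lean` treats only the
3-manifold `∂`, via `FramedLink.IsSurgery`). They are deliberately left to separate definition
items. What this file fixes is the bookkeeping those layers must be compatible with: the event
words, `tb`, `r`, and the framings `tb - 1`; `D.handleCount` can already be fed to
`Literature.HasHandleDecomposition 3 D.handleCount X` (`Handles.lean`) to express "`X` has a handle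
decomposition with the handle numbers of `D`".

## Sources

* R. E. Gompf, *Handlebody construction of Stein surfaces*, Ann. of Math. 148 (1998), 619–693:
  §1 Formulae (1.1), (1.2); §2 Def. 2.1 (standard form), Thm 2.2, framing conventions p. 626,
  Prop. 2.3 (Stein handlebodies). [Gompf1998]
* R. E. Gompf, A. I. Stipsicz, *4-Manifolds and Kirby Calculus* (1999), §11.1.
* Y. Eliashberg, *Topological characterization of Stein manifolds of dimension > 2*,
  Internat. J. Math. 1 (1990), 29–46, Thm 1.3.3.

## Mathlib status and design choices

* Mathlib has no contact geometry, Legendrian knots, fronts or Thurston–Bennequin numbers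
  (`rg -i 'legendrian|thurston.?bennequin|contact form'` in the pinned Mathlib and in
  `Literature/`: nothing relevant). Used: `List.count`, `List.countP`, `Finset.sum`, `ℤˣ`.
* Events are recorded *per component* as a `List` read cyclically from an arbitrary base point
  (as for `GaussDiagram`, whose positions start at a base point); crossings are numbered globally
  (`Fin crossings`) and carry a sign in `ℤˣ` (no junk value), exactly as in `GaussDiagram`.
* The writhe `w(Kᵢ)` entering (1.1) is the signed number of **self**-crossings of `Kᵢ`
  (Gompf 1998, p. 626: "the blackboard framing becomes `w(K)`, the signed number of
  self-crossings of `K`"); crossings between different components contribute to `crossSign i j`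
  only.
* `tb` is *defined* by the second form `w - λ` of (1.1) (an integer with no division) and the
  first form is the lemma `two_mul_tb`; likewise `rot := λ₋ - ρ₊` with `two_mul_rot`.
-/

namespace Literature.Topology.FourManifolds

/-! ## Events along a front -/

/-- The **events** met when traversing (along its orientation) one component of a Legendrian
front in Gompf standard form with `n` 1-handles and `c` crossings (Gompf 1998, Def. 2.1, Fig. 8):
a cusp, lying on the left (`isLeft = true`, "vertex on the left", `λ`) or on the right (`ρ`) and
traversed downwards (`isDown = true`, contributing to `t₋`) or upwards (`t₊`); the passage *over*
(smaller `x`-coordinate side facing the viewer convention of Gompf 1998, Fig. 5) or *under*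
crossing number `k`; or a passage through the 1-handle number `j`, `rightward = true` meaning the
strand leaves the box through the right-hand ball of the `j`-th pair and re-enters through the
left-hand ball. [cite: Gompf1998, Def. 2.1] -/
inductive LegendrianFrontEvent (n c : ℕ) where
  /-- A cusp of the front: on the left or on the right, traversed downwards or upwards. -/
  | cusp (isLeft : Bool) (isDown : Bool)
  /-- The over-strand passage through crossing `k`. -/
  | over (k : Fin c)
  /-- The under-strand passage through crossing `k`. -/
  | under (k : Fin c)
  /-- A passage through the 1-handle `j` (rightwards or leftwards). -/
  | handle (j : Fin n) (rightward : Bool)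
  deriving DecidableEq, Repr

namespace LegendrianFrontEvent

variable {n c : ℕ}

/-- The event is a left cusp (`λ`). [cite: Gompf1998, (1.1)] -/
def isLeftCusp : LegendrianFrontEvent n c → Bool
  | cusp true _ => true
  | _ => false

/-- The event is a right cusp (`ρ`). [cite: Gompf1998, (1.1)] -/
def isRightCusp : LegendrianFrontEvent n c → Bool
  | cusp false _ => true
  | _ => false

/-- The event is a cusp traversed downwards (`t₋`). [cite: Gompf1998, (1.2)] -/
def isDownCusp : LegendrianFrontEvent n c → Bool
  | cusp _ true => true
  | _ => false

/-- The event is a cusp traversed upwards (`t₊`). [cite: Gompf1998, (1.2)] -/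
def isUpCusp : LegendrianFrontEvent n c → Bool
  | cusp _ false => true
  | _ => false

/-- The event is a left cusp traversed downwards (`λ₋`). [cite: Gompf1998, (1.2)] -/
def isLeftDownCusp : LegendrianFrontEvent n c → Bool
  | cusp true true => true
  | _ => false

/-- The event is a left cusp traversed upwards (`λ₊`). [cite: Gompf1998, (1.2)] -/
def isLeftUpCusp : LegendrianFrontEvent n c → Bool
  | cusp true false => true
  | _ => false

/-- The event is a right cusp traversed downwards (`ρ₋`). [cite: Gompf1998, (1.2)] -/
def isRightDownCusp : LegendrianFrontEvent n c → Bool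
  | cusp false true => true
  | _ => false

/-- The event is a right cusp traversed upwards (`ρ₊`). [cite: Gompf1998, (1.2)] -/
def isRightUpCusp : LegendrianFrontEvent n c → Bool
  | cusp false false => true
  | _ => false

end LegendrianFrontEvent

/-! ## Legendrian Kirby diagrams -/

/-- A **Legendrian Kirby diagram in Gompf standard form** (combinatorial layer; Gompf 1998,
Def. 2.1 and Prop. 2.3; Gompf–Stipsicz 1999, §11.1): `oneHandles = n` pairs of attaching balls of
1-handles, `comps = m` oriented Legendrian link components `K₀, …, K_{m-1}` in `#ⁿ S¹ × S²` (along
which the 2-handles are attached, with framings `tb(Kᵢ) - 1`, see `framing`), `crossings = c`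
crossings of the front with signs `sign k ∈ ℤˣ = {1, -1}`, and for each component the cyclic word
`front i` of events (cusps, over/under passages, passages through 1-handles) met along it. The
two strands of crossing `k` belong to the components `overComp k` and `underComp k`, and the
constraints say that crossing `k` is passed over exactly once, namely by `overComp k`, and under
exactly once, namely by `underComp k` (`count_over`, `count_under`), and that each component has as
many left as right cusps (`leftCusps_eq_rightCusps`; left and right cusps alternate along a front,
and passages through 1-handles preserve the direction of travel), so that Gompf's formulae (1.1),
(1.2) for `tb` and `r` take integer values. The data do **not** include a geometric realisation by
a Legendrian tangle in `(ℝ³, dz + x dy)` (see the module docstring). [cite: Gompf1998, Def. 2.1] -/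
structure LegendrianKirbyDiagram where
  /-- The number `n` of 1-handles (pairs of horizontally aligned attaching balls). -/
  oneHandles : ℕ
  /-- The number `m` of link components (= 2-handles). -/
  comps : ℕ
  /-- The number `c` of crossings of the front. -/
  crossings : ℕ
  /-- The sign (local writhe) of each crossing. -/
  sign : Fin crossings → ℤˣ
  /-- The cyclic word of events met along each component. -/
  front : Fin comps → List (LegendrianFrontEvent oneHandles crossings)
  /-- The component of the over-strand of each crossing. -/
  overComp : Fin crossings → Fin comps
  /-- The component of the under-strand of each crossing. -/
  underComp : Fin crossings → Fin comps
  /-- Crossing `k` is passed over exactly once, by the component `overComp k`. -/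
  count_over : ∀ k i, (front i).count (.over k) = if overComp k = i then 1 else 0
  /-- Crossing `k` is passed under exactly once, by the component `underComp k`. -/
  count_under : ∀ k i, (front i).count (.under k) = if underComp k = i then 1 else 0
  /-- Each component has as many left cusps as right cusps. -/
  leftCusps_eq_rightCusps :
    ∀ i, (front i).countP (·.isLeftCusp) = (front i).countP (·.isRightCusp)

namespace LegendrianKirbyDiagram

variable (D : LegendrianKirbyDiagram)

/-- `λ(Kᵢ)`: the number of left cusps of component `i`. [cite: Gompf1998, (1.1)] -/
def leftCusps (i : Fin D.comps) : ℕ := (D.front i).countP (·.isLeftCusp)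

/-- `ρ(Kᵢ)`: the number of right cusps of component `i`. [cite: Gompf1998, (1.1)] -/
def rightCusps (i : Fin D.comps) : ℕ := (D.front i).countP (·.isRightCusp)

/-- The total number of cusps `λ(Kᵢ) + ρ(Kᵢ)` of component `i`. [cite: Gompf1998, (1.1)] -/
def cusps (i : Fin D.comps) : ℕ := D.leftCusps i + D.rightCusps i

/-- `t₋(Kᵢ)`: the number of cusps of component `i` traversed downwards. [cite: Gompf1998, (1.2)] -/
def downCusps (i : Fin D.comps) : ℕ := (D.front i).countP (·.isDownCusp)

/-- `t₊(Kᵢ)`: the number of cusps of component `i` traversed upwards. [cite: Gompf1998, (1.2)] -/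
def upCusps (i : Fin D.comps) : ℕ := (D.front i).countP (·.isUpCusp)

/-- `λ₋(Kᵢ)`: left cusps traversed downwards. [cite: Gompf1998, (1.2)] -/
def leftDownCusps (i : Fin D.comps) : ℕ := (D.front i).countP (·.isLeftDownCusp)

/-- `λ₊(Kᵢ)`: left cusps traversed upwards. [cite: Gompf1998, (1.2)] -/
def leftUpCusps (i : Fin D.comps) : ℕ := (D.front i).countP (·.isLeftUpCusp)

/-- `ρ₋(Kᵢ)`: right cusps traversed downwards. [cite: Gompf1998, (1.2)] -/
def rightDownCusps (i : Fin D.comps) : ℕ := (D.front i).countP (·.isRightDownCusp)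

/-- `ρ₊(Kᵢ)`: right cusps traversed upwards. [cite: Gompf1998, (1.2)] -/
def rightUpCusps (i : Fin D.comps) : ℕ := (D.front i).countP (·.isRightUpCusp)

/-- Left equals right cusps (the structure field, restated for the invariants). [cite: Gompf1998, (1.1)] -/
theorem leftCusps_eq (i : Fin D.comps) : D.leftCusps i = D.rightCusps i :=
  D.leftCusps_eq_rightCusps i

/-- The total number of cusps of a component is even, `= 2 λ`. [folklore] -/
theorem cusps_eq_two_mul (i : Fin D.comps) : D.cusps i = 2 * D.leftCusps i := by
  rw [cusps, ← D.leftCusps_eq, two_mul]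

/-- The signed crossing number of component `i` over component `j`: the sum of the signs of the
crossings whose over-strand lies on `Kᵢ` and under-strand on `Kⱼ`. For `i ≠ j`,
`crossSign i j + crossSign j i = 2 lk(Kᵢ, Kⱼ)` when both are null-homologous. [folklore] -/
def crossSign (i j : Fin D.comps) : ℤ :=
  ∑ k : Fin D.crossings, if D.overComp k = i ∧ D.underComp k = j then (D.sign k : ℤ) else 0

/-- The **writhe** `w(Kᵢ)`: the signed number of self-crossings of the front of component `i`
(Gompf 1998, p. 626: in standard form the blackboard framing corresponds to the integer `w(K)`).
[cite: Gompf1998, §2 p. 626] -/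
def writhe (i : Fin D.comps) : ℤ := D.crossSign i i

/-- The **Thurston–Bennequin number** of component `i` in standard form, Gompf's Formula (1.1):
`tb(K) = w(K) - ½ (λ(K) + ρ(K)) = w(K) - λ(K)`; defined by the second expression (see
`two_mul_tb` for the first). In `#ⁿ S¹ × S²` this integer depends on the diagram convention of
Gompf 1998, §2 (it changes under Move 6). [cite: Gompf1998, (1.1)] -/
def tb (i : Fin D.comps) : ℤ := D.writhe i - D.leftCusps i

/-- Formula (1.1), first form: `2 tb(K) = 2 w(K) - (λ(K) + ρ(K))`. [cite: Gompf1998, (1.1)] -/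
theorem two_mul_tb (i : Fin D.comps) : 2 * D.tb i = 2 * D.writhe i - D.cusps i := by
  rw [tb, D.cusps_eq_two_mul]; push_cast; ring

/-- The **rotation number** of component `i` in standard form, Gompf's Formula (1.2):
`r(K) = λ₋ - ρ₊` (relative to the vector field `∂/∂x` extended over the 1-handles as in
Gompf 1998, §2). [cite: Gompf1998, (1.2)] -/
def rot (i : Fin D.comps) : ℤ := D.leftDownCusps i - D.rightUpCusps i

/-- The **Kirby framing** of the 2-handle attached along component `i` of a Stein handlebody in
standard form: `tb(Kᵢ) - 1` (Gompf 1998, Prop. 2.3; Eliashberg 1990). [cite: Gompf1998, Prop. 2.3] -/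
def framing (i : Fin D.comps) : ℤ := D.tb i - 1

/-- The **algebraic number of passages** of component `i` through the 1-handle `j` (rightward
passages minus leftward ones); twice this number is the change of every framing integer of `Kᵢ`
under Gompf's Move 6. [cite: Gompf1998, §2 p. 626] -/
def algPass (i : Fin D.comps) (j : Fin D.oneHandles) : ℤ :=
  ((D.front i).count (.handle j true) : ℤ) - (D.front i).count (.handle j false)

/-- The **handle numbers** of the 4-dimensional handlebody described by the diagram: one
0-handle, `n` 1-handles, `m` 2-handles and no handles of index `≥ 3` (usable as the argument `c`
of `Literature.HasHandleDecomposition 3 c X`, `Handles.lean`). [cite: Gompf1998, Prop. 2.3] -/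
def handleCount : ℕ → ℕ
  | 0 => 1
  | 1 => D.oneHandles
  | 2 => D.comps
  | _ + 3 => 0

/-! ### Unfolding lemmas -/

/-- Unfolding `tb`. [cite: Gompf1998, (1.1)] -/
theorem tb_def (i : Fin D.comps) : D.tb i = D.writhe i - D.leftCusps i := rfl

/-- Unfolding `framing`. [cite: Gompf1998, Prop. 2.3] -/
theorem framing_def (i : Fin D.comps) : D.framing i = D.tb i - 1 := rfl

/-- Unfolding `rot`. [cite: Gompf1998, (1.2)] -/
theorem rot_def (i : Fin D.comps) : D.rot i = D.leftDownCusps i - D.rightUpCusps i := rfl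

/-- `handleCount` vanishes in degrees `≥ 3` (no 3- or 4-handles). [cite: Gompf1998, Prop. 2.3] -/
@[simp]
theorem handleCount_add_three (k : ℕ) : D.handleCount (k + 3) = 0 := rfl

/-- `handleCount 0 = 1`, `handleCount 1 = n`, `handleCount 2 = m`. [folklore] -/
theorem handleCount_zero_one_two :
    D.handleCount 0 = 1 ∧ D.handleCount 1 = D.oneHandles ∧ D.handleCount 2 = D.comps :=
  ⟨rfl, rfl, rfl⟩

/-! ### Cusp bookkeeping and Formula (1.2) -/

section Cusps

open LegendrianFrontEvent

variable {n c : ℕ}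

/-- Splitting the left-cusp count: `λ = λ₋ + λ₊` on event words. [folklore] -/
theorem countP_isLeftCusp (l : List (LegendrianFrontEvent n c)) :
    l.countP (·.isLeftCusp) = l.countP (·.isLeftDownCusp) + l.countP (·.isLeftUpCusp) := by
  induction l with
  | nil => simp
  | cons e l ih =>
    simp only [List.countP_cons, ih]
    rcases e with ⟨_ | _, _ | _⟩ | _ | _ | _ <;>
      simp [isLeftCusp, isLeftDownCusp, isLeftUpCusp] <;> omega

/-- Splitting the right-cusp count: `ρ = ρ₋ + ρ₊` on event words. [folklore] -/
theorem countP_isRightCusp (l : List (LegendrianFrontEvent n c)) :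
    l.countP (·.isRightCusp) = l.countP (·.isRightDownCusp) + l.countP (·.isRightUpCusp) := by
  induction l with
  | nil => simp
  | cons e l ih =>
    simp only [List.countP_cons, ih]
    rcases e with ⟨_ | _, _ | _⟩ | _ | _ | _ <;>
      simp [isRightCusp, isRightDownCusp, isRightUpCusp] <;> omega

/-- Splitting the downward-cusp count: `t₋ = λ₋ + ρ₋` on event words. [folklore] -/
theorem countP_isDownCusp (l : List (LegendrianFrontEvent n c)) :
    l.countP (·.isDownCusp) = l.countP (·.isLeftDownCusp) + l.countP (·.isRightDownCusp) := by
  induction l with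
  | nil => simp
  | cons e l ih =>
    simp only [List.countP_cons, ih]
    rcases e with ⟨_ | _, _ | _⟩ | _ | _ | _ <;>
      simp [isDownCusp, isLeftDownCusp, isRightDownCusp] <;> omega

/-- Splitting the upward-cusp count: `t₊ = λ₊ + ρ₊` on event words. [folklore] -/
theorem countP_isUpCusp (l : List (LegendrianFrontEvent n c)) :
    l.countP (·.isUpCusp) = l.countP (·.isLeftUpCusp) + l.countP (·.isRightUpCusp) := by
  induction l with
  | nil => simp
  | cons e l ih =>
    simp only [List.countP_cons, ih]
    rcases e with ⟨_ | _, _ | _⟩ | _ | _ | _ <;>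
      simp [isUpCusp, isLeftUpCusp, isRightUpCusp] <;> omega

end Cusps

/-- `λ = λ₋ + λ₊`. [folklore] -/
theorem leftCusps_eq_add (i : Fin D.comps) :
    D.leftCusps i = D.leftDownCusps i + D.leftUpCusps i :=
  countP_isLeftCusp _

/-- `ρ = ρ₋ + ρ₊`. [folklore] -/
theorem rightCusps_eq_add (i : Fin D.comps) :
    D.rightCusps i = D.rightDownCusps i + D.rightUpCusps i :=
  countP_isRightCusp _

/-- `t₋ = λ₋ + ρ₋`. [folklore] -/
theorem downCusps_eq_add (i : Fin D.comps) :
    D.downCusps i = D.leftDownCusps i + D.rightDownCusps i :=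
  countP_isDownCusp _

/-- `t₊ = λ₊ + ρ₊`. [folklore] -/
theorem upCusps_eq_add (i : Fin D.comps) :
    D.upCusps i = D.leftUpCusps i + D.rightUpCusps i :=
  countP_isUpCusp _

/-- Formula (1.2), middle form: `r(K) = λ₋ - ρ₊ = ρ₋ - λ₊` (from `λ = ρ`). [cite: Gompf1998, (1.2)] -/
theorem rot_eq_rightDown_sub_leftUp (i : Fin D.comps) :
    D.rot i = D.rightDownCusps i - D.leftUpCusps i := by
  have h := D.leftCusps_eq i
  rw [D.leftCusps_eq_add, D.rightCusps_eq_add] at h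
  rw [rot]
  omega

/-- Formula (1.2), last form: `2 r(K) = t₋ - t₊`. [cite: Gompf1998, (1.2)] -/
theorem two_mul_rot (i : Fin D.comps) : 2 * D.rot i = D.downCusps i - D.upCusps i := by
  have h := D.rot_eq_rightDown_sub_leftUp i
  rw [D.downCusps_eq_add, D.upCusps_eq_add]
  rw [rot] at h ⊢
  push_cast
  omega

/-! ### The empty diagram -/

/-- The diagram with `n` 1-handles and no 2-handles (the Stein 1-handlebody `♮ⁿ S¹ × B³`,
Gompf 1998, Thm 1.3). [cite: Gompf1998, Def. 2.1] -/
def empty (n : ℕ) : LegendrianKirbyDiagram where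
  oneHandles := n
  comps := 0
  crossings := 0
  sign := Fin.elim0
  front := Fin.elim0
  overComp := Fin.elim0
  underComp := Fin.elim0
  count_over k := k.elim0
  count_under k := k.elim0
  leftCusps_eq_rightCusps i := i.elim0

/-- The default diagram is the empty one without 1-handles (`B⁴`). [folklore] -/
instance : Inhabited LegendrianKirbyDiagram := ⟨empty 0⟩

/-- The empty diagram has handle numbers `(1, n, 0, 0, …)`. [folklore] -/
@[simp]
theorem handleCount_empty_two (n : ℕ) : (empty n).handleCount 2 = 0 := rfl

/-- The empty diagram has `n` 1-handles. [folklore] -/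
@[simp]
theorem oneHandles_empty (n : ℕ) : (empty n).oneHandles = n := rfl

end LegendrianKirbyDiagram

end Literature.Topology.FourManifolds
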